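import Summits.Parity.BatemanHorn.Theorems.SelbergDelangeRigidityLSDRealSegmentTailsTwoSlice
import Summits.Parity.BatemanHorn.Theorems.SelbergDelangeRigidityLSDRealSegmentTailsTwoRescale
import HarnessLib

/-!
# Route `SelbergDelangeRigidity`, crux `LSDRealSegment` (stmt-Parity-9770), line
# `product-anatomy-subcritical`: the rescaled system along one class of a slice (`stub_tailsTwo`)

Fix a Bateman–Horn system `f`, a tuple `s` of `P`-smooth numbers, `M = lcm(s) · P#`, and a residue `r` in the
slice of `s` (every `fᵢ(r)` has exact `P`-smooth part `sᵢ`, as divisibility conditions).  Along the class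
`n = r + M t` the values factor as `fᵢ(n) = sᵢ · Qᵢ(t)` with `Qᵢ ∈ ℤ[X]` (`C sᵢ · Qᵢ = fᵢ ∘ (M X + r)`), and the
rescaled system `Q` satisfies EVERY hypothesis of Nair–Tenenbaum's Theorem 1 with controlled data
(`tailsTwo_class_system`, registered helper): no prime `p ≤ P` divides any value `Qᵢ(t)` (exactness of the slice),
so `ρ_Q(p) = 0` for `p ≤ P`, while `ρ_Q(p) = ρ_f(p)` for `p > P` (affine bijection) — no fixed prime divisor;
each `Qᵢ` is primitive (a prime dividing the content would be `≤ P`, or a fixed prime divisor of `f`), hence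
irreducible; the `Qᵢ` are pairwise coprime over `ℚ`; `ρ_{Qⱼ} ≤ ρ_{fⱼ}` termwise; and in total degree `2` the
discriminant is bounded, `|disc ∏Qᵢ| ≤ (P#)² |disc ∏fᵢ|`, and the height is `≪ (M + r)²`.
-/

open Filter Finset Polynomial
open scoped BigOperators Topology Classical

namespace Summit.Parity.BatemanHorn.Cruxes.LSDRealSegment.ProductAnatomySubcritical

open Literature.NumberTheory.Sieve
open ArithmeticFunction (cardFactors)
noncomputable section

variable {k : ℕ}

section Class

variable {f Q : Fin k → ℤ[X]} {s : Fin k → ℕ} {P r : ℕ}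

/-- The slice predicate propagates along the class `r + M t`. [folklore] -/
theorem slice_add_mul (f : Fin k → ℤ[X]) (s : Fin k → ℕ) (P r : ℕ)
    (hr : ∀ i, ((s i : ℕ) : ℤ) ∣ (f i).eval (r : ℤ) ∧
      ∀ p ∈ Nat.primesLE P, ¬ ((p ^ ((s i).factorization p + 1) : ℕ) : ℤ) ∣ (f i).eval (r : ℤ)) (t : ℕ) :
    ∀ i, ((s i : ℕ) : ℤ) ∣ (f i).eval ((r + Finset.univ.lcm s * primorial P * t : ℕ) : ℤ) ∧
      ∀ p ∈ Nat.primesLE P, ¬ ((p ^ ((s i).factorization p + 1) : ℕ) : ℤ) ∣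
        (f i).eval ((r + Finset.univ.lcm s * primorial P * t : ℕ) : ℤ) := by
  have h := (periodic_slice f s P).map_mod_nat (r + Finset.univ.lcm s * primorial P * t)
  rw [Nat.add_mul_mod_self_left, (periodic_slice f s P).map_mod_nat r] at h
  exact cast h hr

/-- **Exactness**: along the class no prime `p ≤ P` divides a value `Qᵢ(t)` (else `p^{v_p(sᵢ)+1} ∣ fᵢ(n)`). [folklore] -/
theorem not_dvd_rescale_eval (hQ : ∀ i, C (s i : ℤ) * Q i = (f i).comp (C ((Finset.univ.lcm s * primorial P : ℕ) : ℤ) * X + C (r : ℤ)))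
    (hr : ∀ i, ((s i : ℕ) : ℤ) ∣ (f i).eval (r : ℤ) ∧
      ∀ p ∈ Nat.primesLE P, ¬ ((p ^ ((s i).factorization p + 1) : ℕ) : ℤ) ∣ (f i).eval (r : ℤ))
    (i : Fin k) (t : ℕ) {p : ℕ} (hp : p.Prime) (hpP : p ≤ P) : ¬ (p : ℤ) ∣ (Q i).eval (t : ℤ) := by
  intro hdvd
  have hval := rescale_eval (hQ i) (t : ℤ)
  have hcast : ((Finset.univ.lcm s * primorial P : ℕ) : ℤ) * (t : ℤ) + (r : ℤ) =
      ((r + Finset.univ.lcm s * primorial P * t : ℕ) : ℤ) := by push_cast; ring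
  rw [hcast] at hval
  have h1 : ((p ^ ((s i).factorization p + 1) : ℕ) : ℤ) ∣ ((s i : ℕ) : ℤ) * (Q i).eval (t : ℤ) := by
    rw [pow_succ, Nat.cast_mul]
    exact mul_dvd_mul (Int.natCast_dvd_natCast.mpr (Nat.ordProj_dvd (s i) p)) hdvd
  rw [hval] at h1
  exact ((slice_add_mul f s P r hr t) i).2 p (Nat.mem_primesLE.mpr ⟨hpP, hp⟩) h1

/-- `ρ_Q(p) = 0` for primes `p ≤ P`. [folklore] -/
theorem polyRootCountMod_rescale_eq_zero (hQ : ∀ i, C (s i : ℤ) * Q i = (f i).comp (C ((Finset.univ.lcm s * primorial P : ℕ) : ℤ) * X + C (r : ℤ)))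
    (hr : ∀ i, ((s i : ℕ) : ℤ) ∣ (f i).eval (r : ℤ) ∧
      ∀ p ∈ Nat.primesLE P, ¬ ((p ^ ((s i).factorization p + 1) : ℕ) : ℤ) ∣ (f i).eval (r : ℤ))
    {p : ℕ} (hp : p.Prime) (hpP : p ≤ P) : polyRootCountMod Q p = 0 := by
  unfold polyRootCountMod
  rw [Finset.card_eq_zero, Finset.filter_eq_empty_iff]
  intro t _ hdvd
  obtain ⟨i, -, hi⟩ := (Nat.prime_iff_prime_int.mp hp).dvd_finsetProd_iff _ |>.mp hdvd
  exact not_dvd_rescale_eval hQ hr i t hp hpP hi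

/-- `ρ_Q(m) = ρ_f(m)` for moduli `m` prime to `M`. [folklore] -/
theorem polyRootCountMod_rescale_of_coprime (hQ : ∀ i, C (s i : ℤ) * Q i = (f i).comp (C ((Finset.univ.lcm s * primorial P : ℕ) : ℤ) * X + C (r : ℤ)))
    {m : ℕ} (hm : m ≠ 0) (hMm : (Finset.univ.lcm s * primorial P).Coprime m) :
    polyRootCountMod Q m = polyRootCountMod f m :=
  polyRootCountMod_rescale_system hQ hm hMm fun i =>
    Nat.Coprime.coprime_dvd_left ((dvd_univ_lcm s i).trans (Dvd.intro _ rfl)) hMm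

/-- `ρ_{Qⱼ}(m) ≤ ρ_{fⱼ}(m)` for every member and modulus (equality at moduli prime to `M`, zero at prime powers
`p^a`, `p ≤ P`; multiplicativity). [folklore] -/
theorem polyRootCountMod_single_rescale_le (hQ : ∀ i, C (s i : ℤ) * Q i = (f i).comp (C ((Finset.univ.lcm s * primorial P : ℕ) : ℤ) * X + C (r : ℤ)))
    (hr : ∀ i, ((s i : ℕ) : ℤ) ∣ (f i).eval (r : ℤ) ∧
      ∀ p ∈ Nat.primesLE P, ¬ ((p ^ ((s i).factorization p + 1) : ℕ) : ℤ) ∣ (f i).eval (r : ℤ))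
    (hs : ∀ i, s i ≠ 0) (hsP : ∀ i, ∀ p ∈ (s i).primeFactors, p ≤ P) (j : Fin k) :
    ∀ m : ℕ, polyRootCountMod ![Q j] m ≤ polyRootCountMod ![f j] m := by
  refine Nat.recOnPosPrimePosCoprime ?_ (by simp [polyRootCountMod]) (by rw [polyRootCountMod_one, polyRootCountMod_one]) ?_
  · intro p a hp ha
    rcases le_or_gt p P with hpP | hPp
    · -- no root at all
      have : polyRootCountMod ![Q j] (p ^ a) = 0 := by
        rw [polyRootCountMod_single, Finset.card_eq_zero, Finset.filter_eq_empty_iff]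
        intro t _ hdvd
        have h1 : (p : ℤ) ∣ (Q j).eval (t : ℤ) := (dvd_pow_self (p : ℤ) ha.ne').trans (by exact_mod_cast hdvd)
        exact not_dvd_rescale_eval hQ hr j t hp hpP h1
      rw [this]
      exact Nat.zero_le _
    · have hcop : (Finset.univ.lcm s * primorial P).Coprime (p ^ a) :=
        Nat.Coprime.pow_right a (coprime_lcm_mul_primorial hs hsP hp hPp).symm
      rw [polyRootCountMod_rescale (hQ j) (pow_ne_zero a hp.ne_zero) hcop
        (Nat.Coprime.coprime_dvd_left ((dvd_univ_lcm s j).trans (Dvd.intro _ rfl)) hcop)]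
  · intro a b _ _ hab ha hb
    rw [polyRootCountMod_mul_of_coprime_system _ hab, polyRootCountMod_mul_of_coprime_system _ hab]
    exact Nat.mul_le_mul ha hb

/-- **Primitivity**: a prime dividing the content of `Qᵢ` divides every value `Qᵢ(t)`; if `≤ P` this contradicts
exactness, if `> P` it is a fixed prime divisor of `fᵢ` (the class meets every residue class mod `q`), hence of the
system. [folklore] -/
theorem isPrimitive_rescale (hf : IsBatemanHornSystem f)
    (hQ : ∀ i, C (s i : ℤ) * Q i = (f i).comp (C ((Finset.univ.lcm s * primorial P : ℕ) : ℤ) * X + C (r : ℤ)))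
    (hr : ∀ i, ((s i : ℕ) : ℤ) ∣ (f i).eval (r : ℤ) ∧
      ∀ p ∈ Nat.primesLE P, ¬ ((p ^ ((s i).factorization p + 1) : ℕ) : ℤ) ∣ (f i).eval (r : ℤ))
    (hs : ∀ i, s i ≠ 0) (hsP : ∀ i, ∀ p ∈ (s i).primeFactors, p ≤ P) (i : Fin k) : (Q i).IsPrimitive := by
  set M := Finset.univ.lcm s * primorial P with hM
  rw [isPrimitive_iff_isUnit_of_C_dvd]
  intro c hc
  by_contra hcu
  obtain ⟨H, hH⟩ := hc
  have hc0 : c ≠ 0 := by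
    rintro rfl
    rw [C_0, zero_mul] at hH
    have := rescale_natDegree (hQ i) (Nat.pos_of_ne_zero (mul_ne_zero (univ_lcm_ne_zero hs) (primorial_ne_zero P)))
      (Nat.pos_of_ne_zero (hs i))
    rw [hH, natDegree_zero] at this
    exact (hf.natDegree_pos i).ne' this.symm
  obtain ⟨q, hq, hqc⟩ := Nat.exists_prime_and_dvd (n := c.natAbs) (by rwa [Ne, ← Int.isUnit_iff_natAbs_eq])
  have hqc' : (q : ℤ) ∣ c := Int.natCast_dvd.mpr hqc
  have hall : ∀ t : ℤ, (q : ℤ) ∣ (Q i).eval t := fun t => by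
    rw [hH, eval_mul, eval_C]
    exact dvd_mul_of_dvd_left hqc' _
  rcases le_or_gt q P with hqP | hPq
  · exact not_dvd_rescale_eval hQ hr i 0 hq hqP (hall _)
  · -- `q` is a fixed prime divisor of the system
    haveI := Fact.mk hq
    have hcop : M.Coprime q := (coprime_lcm_mul_primorial hs hsP hq hPq).symm
    set u : (ZMod q)ˣ := ZMod.unitOfCoprime M hcop with hu
    have hfix : ∀ n : ℕ, (q : ℤ) ∣ ∏ j, (f j).eval (n : ℤ) := by
      intro n
      set t₀ : ZMod q := ((n : ZMod q) - (r : ZMod q)) * ((u⁻¹ : (ZMod q)ˣ) : ZMod q) with ht₀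
      set t : ℕ := t₀.val with ht
      have hmod : ((M : ℤ) * t + r : ℤ) ≡ (n : ℤ) [ZMOD q] := by
        rw [← ZMod.intCast_eq_intCast_iff]
        push_cast
        rw [ht, ZMod.natCast_zmod_val, ht₀, show ((M : ZMod q)) = (u : ZMod q) by rw [hu, ZMod.coe_unitOfCoprime]]
        rw [mul_comm ((n : ZMod q) - r), ← mul_assoc, Units.mul_inv, one_mul, sub_add_cancel]
      have h1 : (q : ℤ) ∣ (f i).eval ((M : ℤ) * t + r) := by
        rw [← rescale_eval (hQ i) (t : ℤ)]
        exact dvd_mul_of_dvd_right (hall _) _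
      have h2 : (q : ℤ) ∣ (f i).eval (n : ℤ) - (f i).eval ((M : ℤ) * t + r) :=
        (Int.ModEq.dvd hmod).trans (Polynomial.sub_dvd_eval_sub _ _ _)
      have h3 : (q : ℤ) ∣ (f i).eval (n : ℤ) := by
        have := dvd_add h2 h1
        rwa [sub_add_cancel] at this
      exact h3.trans (Finset.dvd_prod_of_mem (fun j => (f j).eval (n : ℤ)) (Finset.mem_univ i))
    have hρ : polyRootCountMod f q = q := by
      unfold polyRootCountMod
      rw [Finset.filter_true_of_mem fun n _ => hfix n, Finset.card_range]
    exact absurd (hf.hasNoFixedPrimeDivisor q hq) (by rw [hρ]; exact lt_irrefl q)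

end Class

/-- The product of a Bateman–Horn system rescaled member by member. [folklore] -/
theorem prod_rescale_eq {f Q : Fin k → ℤ[X]} {b : Fin k → ℕ} {M : ℕ} {r : ℤ}
    (hQ : ∀ i, C (b i : ℤ) * Q i = (f i).comp (C (M : ℤ) * X + C r)) :
    C ((∏ i, b i : ℕ) : ℤ) * ∏ i, Q i = (∏ i, f i).comp (C (M : ℤ) * X + C r) := by
  rw [Polynomial.prod_comp, ← Finset.prod_congr rfl fun i _ => hQ i, Finset.prod_mul_distrib, Nat.cast_prod, map_prod]

/-- **tailsTwo_class_system** (registered helper of `stub_tailsTwo`, line `product-anatomy-subcritical`): along one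
class `r` of the slice of a `P`-smooth tuple `s` (modulus `M = lcm(s)·P#`) of a Bateman–Horn system of total degree
`2`, the rescaled system `Qᵢ = fᵢ(r + M t)/sᵢ` exists in `ℤ[X]` and satisfies the hypotheses of Nair–Tenenbaum's
Theorem 1 with controlled data: irreducible members, pairwise coprime over `ℚ`, no fixed prime divisor, total degree
`2`, `|disc ∏Qᵢ| ≤ (P#)²|disc ∏fᵢ|`, height `≤ H_f (M + r)²`; moreover `ρ_Q(p) = 0` (`p ≤ P`), `ρ_Q(p) = ρ_f(p)`
(`p > P`), `ρ_{Qⱼ} ≤ ρ_{fⱼ}`, no prime `≤ P` divides a value `Qᵢ(t)`, and `sᵢ Qᵢ(t) = fᵢ(r + M t)`. [folklore] -/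
theorem tailsTwo_class_system : ∀ (k : ℕ) (f : Fin k → ℤ[X]), IsBatemanHornSystem f → (∑ i, (f i).natDegree) = 2 →
    ∀ (s : Fin k → ℕ) (P r : ℕ), (∀ i, s i ≠ 0) → (∀ i, ∀ p ∈ (s i).primeFactors, p ≤ P) →
    (∀ i, ((s i : ℕ) : ℤ) ∣ (f i).eval (r : ℤ) ∧
      ∀ p ∈ Nat.primesLE P, ¬ ((p ^ ((s i).factorization p + 1) : ℕ) : ℤ) ∣ (f i).eval (r : ℤ)) →
    ∃ Q : Fin k → ℤ[X],
      (∀ i, C (s i : ℤ) * Q i = (f i).comp (C ((Finset.univ.lcm s * primorial P : ℕ) : ℤ) * X + C (r : ℤ))) ∧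
      (∀ i, Irreducible (Q i)) ∧
      (∀ i j, i ≠ j → IsCoprime ((Q i).map (Int.castRingHom ℚ)) ((Q j).map (Int.castRingHom ℚ))) ∧
      HasNoFixedPrimeDivisor Q ∧ (∏ i, Q i).natDegree = 2 ∧
      |(∏ i, Q i).discr| ≤ ((primorial P : ℕ) : ℤ) ^ 2 * |(∏ i, f i).discr| ∧
      polyHeight (∏ i, Q i) ≤ (((∏ i, f i).coeff 2).natAbs + ((∏ i, f i).coeff 1).natAbs + ((∏ i, f i).coeff 0).natAbs) *
        (Finset.univ.lcm s * primorial P + r) ^ 2 ∧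
      (∀ p : ℕ, p.Prime → p ≤ P → polyRootCountMod Q p = 0) ∧
      (∀ p : ℕ, p.Prime → P < p → polyRootCountMod Q p = polyRootCountMod f p) ∧
      (∀ (j : Fin k) (m : ℕ), polyRootCountMod ![Q j] m ≤ polyRootCountMod ![f j] m) ∧
      (∀ (i : Fin k) (t : ℕ) (p : ℕ), p.Prime → p ≤ P → ¬ (p : ℤ) ∣ (Q i).eval (t : ℤ)) ∧
      (∀ (i : Fin k) (t : ℕ), ((s i : ℕ) : ℤ) * (Q i).eval (t : ℤ) =
        (f i).eval ((r + Finset.univ.lcm s * primorial P * t : ℕ) : ℤ)) := by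
  intro k f hf hdeg s P r hs hsP hr
  set M := Finset.univ.lcm s * primorial P with hM
  have hM0 : 0 < M := Nat.pos_of_ne_zero (mul_ne_zero (univ_lcm_ne_zero hs) (primorial_ne_zero P))
  have hsM : ∀ i, s i ∣ M := fun i => (dvd_univ_lcm s i).trans (Dvd.intro _ rfl)
  choose Q hQ using fun i => exists_rescale (f i) (r : ℤ) (hsM i) (hr i).1
  have hf0 : ∀ i, f i ≠ 0 := fun i => (hf.irreducible i).ne_zero
  have hQdeg : ∀ i, (Q i).natDegree = (f i).natDegree := fun i =>
    rescale_natDegree (hQ i) hM0 (Nat.pos_of_ne_zero (hs i))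
  have hQ0 : ∀ i, Q i ≠ 0 := fun i h => by
    have := hQdeg i
    rw [h, natDegree_zero] at this
    exact (hf.natDegree_pos i).ne' this.symm
  -- the product
  have hF : (∏ i, f i).natDegree = 2 := by rw [natDegree_prod _ _ fun i _ => hf0 i, hdeg]
  have hprod : C ((∏ i, s i : ℕ) : ℤ) * ∏ i, Q i = (∏ i, f i).comp (C (M : ℤ) * X + C (r : ℤ)) := prod_rescale_eq hQ
  have hB0 : 0 < ∏ i, s i := Finset.prod_pos fun i _ => Nat.pos_of_ne_zero (hs i)
  have hLB : Finset.univ.lcm s ≤ ∏ i, s i :=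
    Nat.le_of_dvd hB0 (Finset.lcm_dvd fun i _ => Finset.dvd_prod_of_mem s (Finset.mem_univ i))
  refine ⟨Q, hQ, fun i => ?_, fun i j hij => ?_, fun p hp => ?_, ?_, ?_, ?_, fun p hp hpP => ?_, fun p hp hPp => ?_,
    fun j m => ?_, fun i t p hp hpP => ?_, fun i t => ?_⟩
  · exact rescale_irreducible (hQ i) hM0 (Nat.pos_of_ne_zero (hs i)) (hf.irreducible i) (hf.natDegree_pos i)
      (isPrimitive_rescale hf hQ hr hs hsP i)
  · exact isCoprime_rescale (hQ i) (hQ j) (isCoprime_map_of_isBatemanHornSystem hf hij)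
  · rcases le_or_gt p P with hpP | hPp
    · rw [polyRootCountMod_rescale_eq_zero hQ hr hp hpP]
      exact hp.pos
    · rw [polyRootCountMod_rescale_of_coprime hQ hp.ne_zero (coprime_lcm_mul_primorial hs hsP hp hPp).symm]
      exact hf.hasNoFixedPrimeDivisor p hp
  · rw [natDegree_prod _ _ fun i _ => hQ0 i, Finset.sum_congr rfl fun i _ => hQdeg i, hdeg]
  · have hdisc := tailsTwo_rescale_discr (∏ i, f i) (∏ i, Q i) r M (∏ i, s i) hF hM0 hB0 hprod
    -- `B² |disc G| = M² |disc F| ≤ B² P#² |disc F|`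
    have hB0' : (0 : ℤ) < ((∏ i, s i : ℕ) : ℤ) ^ 2 := by positivity
    have hMle : (M : ℤ) ≤ ((∏ i, s i : ℕ) : ℤ) * (primorial P : ℕ) := by
      rw [hM]
      push_cast
      exact_mod_cast Nat.mul_le_mul_right _ hLB
    have key : ((∏ i, s i : ℕ) : ℤ) ^ 2 * |(∏ i, Q i).discr| ≤
        ((∏ i, s i : ℕ) : ℤ) ^ 2 * (((primorial P : ℕ) : ℤ) ^ 2 * |(∏ i, f i).discr|) := by
      calc ((∏ i, s i : ℕ) : ℤ) ^ 2 * |(∏ i, Q i).discr| = |((∏ i, s i : ℕ) : ℤ) ^ 2 * (∏ i, Q i).discr| := by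
            rw [abs_mul, abs_of_pos hB0']
        _ = (M : ℤ) ^ 2 * |(∏ i, f i).discr| := by rw [hdisc, abs_mul, abs_pow, abs_of_nonneg (by positivity)]
        _ ≤ (((∏ i, s i : ℕ) : ℤ) * (primorial P : ℕ)) ^ 2 * |(∏ i, f i).discr| :=
            mul_le_mul_of_nonneg_right (pow_le_pow_left₀ (by positivity) hMle 2) (abs_nonneg _)
        _ = _ := by ring
    exact le_of_mul_le_mul_left key hB0'
  · exact polyHeight_rescale_le_of_natDegree_eq_two hF hM0 hB0 hprod
  · exact polyRootCountMod_rescale_eq_zero hQ hr hp hpP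
  · exact polyRootCountMod_rescale_of_coprime hQ hp.ne_zero (coprime_lcm_mul_primorial hs hsP hp hPp).symm
  · exact polyRootCountMod_single_rescale_le hQ hr hs hsP j m
  · exact not_dvd_rescale_eval hQ hr i t hp hpP
  · rw [rescale_eval (hQ i) (t : ℤ)]
    congr 1
    push_cast
    ring

end

end Summit.Parity.BatemanHorn.Cruxes.LSDRealSegment.ProductAnatomySubcritical
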